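import Mathlib
import HarnessLib
import Literature.Analysis.PDE.LaplacianInequalities
import Literature.Analysis.Calculus.PlaneIsoparametric
import Literature.Analysis.Calculus.PlaneIsoparametricCircles

/-!
# Isoparametric functions in the plane, III: PARALLEL LINES where `λ₂ ≡ 0`, and the Levi-Civita–Segre DICHOTOMY
# [cite: CecilRyan1985, Ch. 3 §5] [cite: Segre1938Isoparametric]

Analysis/Calculus support file (everything proved, no named facts), sequel of `PlaneIsoparametric` (I) and
`PlaneIsoparametricCircles` (II).  For a planar isoparametric function `W` (`(∂₀W)² + (∂₁W)² = a(W)`,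
`∂₀∂₀W + ∂₁∂₁W = b(W)`, `λ₁ = a′/2`, `λ₂ = b − a′/2`):

* `parallel_of_isoparametric_flat` — **PARALLEL LINES**: if `λ₂(W) ≡ 0` on an open set `U` where `∇W ≠ 0`, then near
  every point the direction of `∇W` is constant: `∂₀W(y) ∂₁W(x) = ∂₁W(y) ∂₀W(x)` on a ball around `x` (the level curves
  are parallel straight lines; proof: the projector `∇W⊗∇W/|∇W|²` has zero derivative since `D²W = λ₁ n⊗n`).
* `circles_or_lines_of_isoparametric` — **THE DICHOTOMY** (Levi-Civita–Segre in `ℝ²`, local form): if `W` is `C³`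
  and isoparametric on an open `U` (`a ∈ C²`, `b ∈ C¹`) and `∇W(x) ≠ 0` at some `x ∈ U`, then on some nonempty open
  `V ⊆ U` EITHER `∇W(y) = λ₂(W y)(y − c)` for a fixed centre `c` (concentric circles) OR `∇W(y)` is parallel to a
  fixed non-zero vector (parallel lines) [cite: CecilRyan1985, Ch. 3 §5] [cite: Segre1938Isoparametric].

Consumer: the structural route to the poloidal Type-I Liouville crux of `Summits/NavierStokesRegularity`: an
isoparametric vortex-line foliation of a horizontal slice carries the rotation germ (circles) or the translation germ
(lines) of the vorticity.

WHAT THIS IS NOT: no statement in dimension `≥ 3`; the open set `V` of the dichotomy need not contain the given point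
(it does when `λ₂(W x) ≠ 0` or when `λ₂ ∘ W` vanishes near `x`).
-/

noncomputable section

namespace Literature.Analysis.Calculus.PlaneIsoparametric

open Set Function Filter InnerProductSpace Metric
open scoped Laplacian ContDiff
open _root_.Topology

section Lines

/-- A vector of `ℝ²` in the standard basis. [folklore] -/
private theorem vec_eq_sum_two (v : EuclideanSpace ℝ (Fin 2)) :
    v = v 0 • (EuclideanSpace.single 0 (1 : ℝ) : EuclideanSpace ℝ (Fin 2)) +
      v 1 • (EuclideanSpace.single 1 (1 : ℝ) : EuclideanSpace ℝ (Fin 2)) := by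
  ext i
  fin_cases i <;> simp

variable {W : EuclideanSpace ℝ (Fin 2) → ℝ} {a b : ℝ → ℝ} {U : Set (EuclideanSpace ℝ (Fin 2))}
  {x : EuclideanSpace ℝ (Fin 2)}

/-- All four Hessian entries of an isoparametric function at a point, in the uniform form
`a(W)·∂ₖ∂ᵢW = λ₁ ∂ᵢW ∂ₖW + λ₂ (a(W) δᵢₖ − ∂ᵢW ∂ₖW)`. [cite: CecilRyan1985, Ch. 3 §5] -/
theorem hessian_entry_of_isoparametric (hU : IsOpen U) (hx : x ∈ U) (hW : ContDiffOn ℝ 3 W U)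
    (ha : ContDiff ℝ 2 a)
    (h₁ : ∀ y ∈ U, (fderiv ℝ W y (EuclideanSpace.single 0 1)) ^ 2 +
      (fderiv ℝ W y (EuclideanSpace.single 1 1)) ^ 2 = a (W y))
    (h₂ : ∀ y ∈ U, fderiv ℝ (fun z => fderiv ℝ W z (EuclideanSpace.single 0 1)) y (EuclideanSpace.single 0 1) +
      fderiv ℝ (fun z => fderiv ℝ W z (EuclideanSpace.single 1 1)) y (EuclideanSpace.single 1 1) = b (W y))
    (i k : Fin 2) :
    a (W x) * fderiv ℝ (fun z => fderiv ℝ W z (EuclideanSpace.single i 1)) x (EuclideanSpace.single k 1) =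
      deriv a (W x) / 2 * (fderiv ℝ W x (EuclideanSpace.single i 1) * fderiv ℝ W x (EuclideanSpace.single k 1)) +
        (b (W x) - deriv a (W x) / 2) * (a (W x) * (if i = k then 1 else 0) -
          fderiv ℝ W x (EuclideanSpace.single i 1) * fderiv ℝ W x (EuclideanSpace.single k 1)) := by
  have hUx : U ∈ 𝓝 x := hU.mem_nhds hx
  have hW2 : ContDiffAt ℝ 2 W x := (hW.contDiffAt hUx).of_le (by norm_num)
  have hev : ∀ᶠ y in 𝓝 x, (fderiv ℝ W y (EuclideanSpace.single 0 1)) ^ 2 +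
      (fderiv ℝ W y (EuclideanSpace.single 1 1)) ^ 2 = a (W y) := by
    filter_upwards [hUx] with y hy using h₁ y hy
  obtain ⟨hr, hs, ht⟩ := hessian_of_isoparametric hW2 ((ha.differentiable (by norm_num)) (W x)).hasDerivAt hev (h₂ x hx)
  have hsym : fderiv ℝ (fun y => fderiv ℝ W y (EuclideanSpace.single 1 1)) x (EuclideanSpace.single 0 1) =
      fderiv ℝ (fun y => fderiv ℝ W y (EuclideanSpace.single 0 1)) x (EuclideanSpace.single 1 1) :=
    Literature.Analysis.PDE.fderiv_fderiv_apply_comm hW2 _ _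
  have hA := h₁ x hx
  fin_cases i <;> fin_cases k
  · simp only [Fin.zero_eta, Fin.isValue, ↓reduceIte, mul_one]
    linear_combination hr -
      (fderiv ℝ (fun z => fderiv ℝ W z (EuclideanSpace.single 0 1)) x (EuclideanSpace.single 0 1) -
        (b (W x) - deriv a (W x) / 2)) * hA
  · simp only [Fin.zero_eta, Fin.isValue, Fin.mk_one, zero_ne_one, ↓reduceIte, mul_zero, zero_sub]
    linear_combination hs -
      fderiv ℝ (fun z => fderiv ℝ W z (EuclideanSpace.single 0 1)) x (EuclideanSpace.single 1 1) * hA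
  · simp only [Fin.mk_one, Fin.isValue, Fin.zero_eta, one_ne_zero, ↓reduceIte, mul_zero, zero_sub]
    rw [hsym]
    linear_combination hs -
      fderiv ℝ (fun z => fderiv ℝ W z (EuclideanSpace.single 0 1)) x (EuclideanSpace.single 1 1) * hA
  · simp only [Fin.mk_one, Fin.isValue, ↓reduceIte, mul_one]
    linear_combination ht -
      (fderiv ℝ (fun z => fderiv ℝ W z (EuclideanSpace.single 1 1)) x (EuclideanSpace.single 1 1) -
        (b (W x) - deriv a (W x) / 2)) * hA

/-- **PARALLEL LINES (Levi-Civita–Segre in the plane, the case `λ₂ ≡ 0`).**  Let `W` be `C³` and isoparametric on an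
open `U` with `λ₂(W) = b(W) − a′(W)/2 ≡ 0` on `U`, and `x ∈ U` with `∇W(x) ≠ 0`.  Then on some ball `B(x,ε) ⊆ U` the
direction of the gradient is constant: `∂₀W(y) ∂₁W(x) = ∂₁W(y) ∂₀W(x)` — the level curves are parallel straight lines.
[cite: CecilRyan1985, Ch. 3 §5] [cite: Segre1938Isoparametric] -/
theorem parallel_of_isoparametric_flat (hU : IsOpen U) (hx : x ∈ U) (hW : ContDiffOn ℝ 3 W U)
    (ha : ContDiff ℝ 2 a)
    (h₁ : ∀ y ∈ U, (fderiv ℝ W y (EuclideanSpace.single 0 1)) ^ 2 +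
      (fderiv ℝ W y (EuclideanSpace.single 1 1)) ^ 2 = a (W y))
    (h₂ : ∀ y ∈ U, fderiv ℝ (fun z => fderiv ℝ W z (EuclideanSpace.single 0 1)) y (EuclideanSpace.single 0 1) +
      fderiv ℝ (fun z => fderiv ℝ W z (EuclideanSpace.single 1 1)) y (EuclideanSpace.single 1 1) = b (W y))
    (hflat : ∀ y ∈ U, b (W y) - deriv a (W y) / 2 = 0) (hpos : 0 < a (W x)) :
    ∃ ε : ℝ, 0 < ε ∧ ball x ε ⊆ U ∧ ∀ y ∈ ball x ε,
      fderiv ℝ W y (EuclideanSpace.single 0 1) * fderiv ℝ W x (EuclideanSpace.single 1 1) =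
        fderiv ℝ W y (EuclideanSpace.single 1 1) * fderiv ℝ W x (EuclideanSpace.single 0 1) := by
  -- ## a ball inside `U` on which `a(W) > 0`
  have hUx : U ∈ 𝓝 x := hU.mem_nhds hx
  have hWc : ContinuousAt W x := (hW.contDiffAt hUx).continuousAt
  have hApc : ContinuousAt (fun y => a (W y)) x := ha.continuous.continuousAt.comp hWc
  have hev : ∀ᶠ y in 𝓝 x, y ∈ U ∧ 0 < a (W y) := by
    filter_upwards [hUx, hApc.eventually (lt_mem_nhds hpos)] with y h1 h2
    exact ⟨h1, h2⟩
  obtain ⟨ε, hε, hball⟩ := Metric.eventually_nhds_iff_ball.1 hev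
  have ha1 : Differentiable ℝ a := ha.differentiable (by norm_num)
  -- ## the projector entries `uᵢⱼ = ∂ᵢW ∂ⱼW / a(W)` have zero derivative on the ball
  set u : Fin 2 → Fin 2 → EuclideanSpace ℝ (Fin 2) → ℝ := fun i j y =>
    fderiv ℝ W y (EuclideanSpace.single i 1) * fderiv ℝ W y (EuclideanSpace.single j 1) * (a (W y))⁻¹ with hu
  have hstep : ∀ i j, ∀ y ∈ ball x ε, DifferentiableAt ℝ (u i j) y ∧ fderiv ℝ (u i j) y = 0 := by
    intro i j y hy
    obtain ⟨hyU, hypos⟩ := hball y hy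
    have hW2 : ContDiffAt ℝ 2 W y := (hW.contDiffAt (hU.mem_nhds hyU)).of_le (by norm_num)
    have hWd : DifferentiableAt ℝ W y := hW2.differentiableAt (by norm_num)
    have hPd : ∀ i : Fin 2, DifferentiableAt ℝ (fun z => fderiv ℝ W z (EuclideanSpace.single i 1)) y := by
      intro i
      have h := (hW2.fderiv_right (m := 1) (by norm_num)).differentiableAt (by norm_num)
      exact (ContinuousLinearMap.apply ℝ ℝ (EuclideanSpace.single i (1 : ℝ))).differentiableAt.comp y h
    have hAd : HasFDerivAt (fun z => a (W z)) (deriv a (W y) • fderiv ℝ W y) y :=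
      (ha1 (W y)).hasDerivAt.comp_hasFDerivAt y hWd.hasFDerivAt
    have hAne : a (W y) ≠ 0 := hypos.ne'
    have hAinv : HasFDerivAt (fun z => (a (W z))⁻¹) ((-(a (W y) ^ 2)⁻¹) • (deriv a (W y) • fderiv ℝ W y)) y := by
      have h := (hasDerivAt_inv hAne).comp_hasFDerivAt y hAd
      simpa [Function.comp_def] using h
    have hprod : HasFDerivAt (u i j)
        ((fderiv ℝ W y (EuclideanSpace.single i 1) * fderiv ℝ W y (EuclideanSpace.single j 1)) •
            ((-(a (W y) ^ 2)⁻¹) • (deriv a (W y) • fderiv ℝ W y)) +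
          (a (W y))⁻¹ • (fderiv ℝ W y (EuclideanSpace.single i 1) •
              fderiv ℝ (fun z => fderiv ℝ W z (EuclideanSpace.single j 1)) y +
            fderiv ℝ W y (EuclideanSpace.single j 1) •
              fderiv ℝ (fun z => fderiv ℝ W z (EuclideanSpace.single i 1)) y)) y :=
      ((hPd i).hasFDerivAt.mul (hPd j).hasFDerivAt).mul hAinv
    refine ⟨hprod.differentiableAt, ?_⟩
    rw [hprod.fderiv]
    -- all components vanish
    have hH := fun i k => hessian_entry_of_isoparametric hU hyU hW ha h₁ h₂ i k
    have hL0 := hflat y hyU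
    ext v
    rw [vec_eq_sum_two v]
    simp only [map_add, map_smul, _root_.add_apply, FunLike.coe_smul, Pi.smul_apply, smul_eq_mul,
      zero_apply]
    have hz : ∀ k : Fin 2,
        fderiv ℝ W y (EuclideanSpace.single i 1) * fderiv ℝ W y (EuclideanSpace.single j 1) *
            (-(a (W y) ^ 2)⁻¹ * (deriv a (W y) * fderiv ℝ W y (EuclideanSpace.single k 1))) +
          (a (W y))⁻¹ * (fderiv ℝ W y (EuclideanSpace.single i 1) *
              fderiv ℝ (fun z => fderiv ℝ W z (EuclideanSpace.single j 1)) y (EuclideanSpace.single k 1) +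
            fderiv ℝ W y (EuclideanSpace.single j 1) *
              fderiv ℝ (fun z => fderiv ℝ W z (EuclideanSpace.single i 1)) y (EuclideanSpace.single k 1)) = 0 := by
      intro k
      have hik := hH i k
      have hjk := hH j k
      rw [hL0, zero_mul, add_zero] at hik hjk
      -- A² · (expression) = pᵢ (A Wⱼₖ − λ₁ pⱼ pₖ) + pⱼ (A Wᵢₖ − λ₁ pᵢ pₖ) = 0
      have hA2 : a (W y) ^ 2 ≠ 0 := pow_ne_zero 2 hAne
      have key : a (W y) ^ 2 *
          (fderiv ℝ W y (EuclideanSpace.single i 1) * fderiv ℝ W y (EuclideanSpace.single j 1) *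
              (-(a (W y) ^ 2)⁻¹ * (deriv a (W y) * fderiv ℝ W y (EuclideanSpace.single k 1))) +
            (a (W y))⁻¹ * (fderiv ℝ W y (EuclideanSpace.single i 1) *
                fderiv ℝ (fun z => fderiv ℝ W z (EuclideanSpace.single j 1)) y (EuclideanSpace.single k 1) +
              fderiv ℝ W y (EuclideanSpace.single j 1) *
                fderiv ℝ (fun z => fderiv ℝ W z (EuclideanSpace.single i 1)) y (EuclideanSpace.single k 1))) =
          fderiv ℝ W y (EuclideanSpace.single i 1) *
              (a (W y) * fderiv ℝ (fun z => fderiv ℝ W z (EuclideanSpace.single j 1)) y (EuclideanSpace.single k 1) -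
                deriv a (W y) / 2 * (fderiv ℝ W y (EuclideanSpace.single j 1) * fderiv ℝ W y (EuclideanSpace.single k 1))) +
            fderiv ℝ W y (EuclideanSpace.single j 1) *
              (a (W y) * fderiv ℝ (fun z => fderiv ℝ W z (EuclideanSpace.single i 1)) y (EuclideanSpace.single k 1) -
                deriv a (W y) / 2 * (fderiv ℝ W y (EuclideanSpace.single i 1) * fderiv ℝ W y (EuclideanSpace.single k 1))) := by
        field_simp
        ring
      rw [hjk, hik, sub_self, sub_self, mul_zero, mul_zero, add_zero] at key
      exact (mul_eq_zero.1 key).resolve_left hA2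
    rw [hz 0, hz 1]
  -- ## hence constant on the ball
  have hconst : ∀ i j, ∀ y ∈ ball x ε, u i j y = u i j x := by
    intro i j y hy
    have hconv : Convex ℝ (ball x ε) := convex_ball x ε
    have hdo : DifferentiableOn ℝ (u i j) (ball x ε) := fun z hz => (hstep i j z hz).1.differentiableWithinAt
    have hzero : ∀ z ∈ ball x ε, fderivWithin ℝ (u i j) (ball x ε) z = 0 := by
      intro z hz
      rw [fderivWithin_of_isOpen isOpen_ball hz]
      exact (hstep i j z hz).2
    exact hconv.is_const_of_fderivWithin_eq_zero hdo hzero hy (mem_ball_self hε)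
  -- ## conclusion: the direction of ∇W is that of ∇W(x)
  refine ⟨ε, hε, fun y hy => (hball y hy).1, fun y hy => ?_⟩
  obtain ⟨hyU, hypos⟩ := hball y hy
  have h00 := hconst 0 0 y hy
  have h01 := hconst 0 1 y hy
  have h11 := hconst 1 1 y hy
  simp only [hu] at h00 h01 h11
  set p := fderiv ℝ W y (EuclideanSpace.single 0 1)
  set q := fderiv ℝ W y (EuclideanSpace.single 1 1)
  set p₀ := fderiv ℝ W x (EuclideanSpace.single 0 1)
  set q₀ := fderiv ℝ W x (EuclideanSpace.single 1 1)
  have hAy : a (W y) ≠ 0 := hypos.ne'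
  have hAx : a (W x) ≠ 0 := hpos.ne'
  have hA0 : p₀ ^ 2 + q₀ ^ 2 = a (W x) := h₁ x hx
  -- a(W x) · (p q₀ − q p₀)² = 0
  field_simp at h00 h01 h11
  have hsq0 : a (W x) * (p * q₀ - q * p₀) ^ 2 = 0 := by
    linear_combination q₀ ^ 2 * h00 - 2 * p₀ * q₀ * h01 + p₀ ^ 2 * h11
  have hsq : (p * q₀ - q * p₀) ^ 2 = 0 := (mul_eq_zero.1 hsq0).resolve_left hAx
  have h0 : p * q₀ - q * p₀ = 0 := pow_eq_zero_iff (n := 2) (by norm_num) |>.1 hsq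
  linarith

/-- **THE LEVI-CIVITA–SEGRE DICHOTOMY IN THE PLANE (local form).**  Let `W` be `C³` on an open `U ⊆ ℝ²` and
isoparametric there: `(∂₀W)² + (∂₁W)² = a(W)`, `∂₀∂₀W + ∂₁∂₁W = b(W)` with `a ∈ C²`, `b ∈ C¹`; let `x ∈ U` with
`∇W(x) ≠ 0` (`a(W x) > 0`).  Then there is a nonempty open `V ⊆ U` on which EITHER the gradient is radial from a fixed
centre, `∇W(y) = λ₂(W y)(y − c)` (the level curves are CONCENTRIC CIRCLES), OR the gradient has a fixed direction,
`∂₀W(y) q₀ = ∂₁W(y) p₀` with `(p₀,q₀) = ∇W(x) ≠ 0` (the level curves are PARALLEL LINES).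
[cite: CecilRyan1985, Ch. 3 §5] [cite: Segre1938Isoparametric] -/
theorem circles_or_lines_of_isoparametric (hU : IsOpen U) (hx : x ∈ U) (hW : ContDiffOn ℝ 3 W U)
    (ha : ContDiff ℝ 2 a) (hb : ContDiff ℝ 1 b)
    (h₁ : ∀ y ∈ U, (fderiv ℝ W y (EuclideanSpace.single 0 1)) ^ 2 +
      (fderiv ℝ W y (EuclideanSpace.single 1 1)) ^ 2 = a (W y))
    (h₂ : ∀ y ∈ U, fderiv ℝ (fun z => fderiv ℝ W z (EuclideanSpace.single 0 1)) y (EuclideanSpace.single 0 1) +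
      fderiv ℝ (fun z => fderiv ℝ W z (EuclideanSpace.single 1 1)) y (EuclideanSpace.single 1 1) = b (W y))
    (hpos : 0 < a (W x)) :
    ∃ V : Set (EuclideanSpace ℝ (Fin 2)), IsOpen V ∧ V.Nonempty ∧ V ⊆ U ∧
      ((∃ c : EuclideanSpace ℝ (Fin 2), ∀ y ∈ V, ∀ i : Fin 2,
          fderiv ℝ W y (EuclideanSpace.single i 1) = (b (W y) - deriv a (W y) / 2) * (y i - c i)) ∨
       ((fderiv ℝ W x (EuclideanSpace.single 0 1) ≠ 0 ∨ fderiv ℝ W x (EuclideanSpace.single 1 1) ≠ 0) ∧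
          ∀ y ∈ V, fderiv ℝ W y (EuclideanSpace.single 0 1) * fderiv ℝ W x (EuclideanSpace.single 1 1) =
            fderiv ℝ W y (EuclideanSpace.single 1 1) * fderiv ℝ W x (EuclideanSpace.single 0 1))) := by
  -- a ball inside `U` on which `a(W) > 0`
  have hUx : U ∈ 𝓝 x := hU.mem_nhds hx
  have hWc : ContinuousAt W x := (hW.contDiffAt hUx).continuousAt
  have hApc : ContinuousAt (fun y => a (W y)) x := ha.continuous.continuousAt.comp hWc
  have hev : ∀ᶠ y in 𝓝 x, y ∈ U ∧ 0 < a (W y) := by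
    filter_upwards [hUx, hApc.eventually (lt_mem_nhds hpos)] with y h1 h2
    exact ⟨h1, h2⟩
  obtain ⟨ε, hε, hball⟩ := Metric.eventually_nhds_iff_ball.1 hev
  have hBU : ball x ε ⊆ U := fun y hy => (hball y hy).1
  by_cases hcase : ∃ y ∈ ball x ε, b (W y) - deriv a (W y) / 2 ≠ 0
  · -- CIRCLES near such a point
    obtain ⟨y, hy, hLy⟩ := hcase
    obtain ⟨c, δ, hδ, hδU, -, hrad⟩ :=
      exists_centre_of_isoparametric hU (hBU hy) hW ha hb h₁ h₂ (hball y hy).2 hLy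
    exact ⟨ball y δ, isOpen_ball, ⟨y, mem_ball_self hδ⟩, hδU, Or.inl ⟨c, hrad⟩⟩
  · -- LINES: `λ₂ ∘ W ≡ 0` on the ball
    push Not at hcase
    have hW' : ContDiffOn ℝ 3 W (ball x ε) := hW.mono hBU
    obtain ⟨δ, hδ, hδB, hpar⟩ := parallel_of_isoparametric_flat (U := ball x ε) isOpen_ball (mem_ball_self hε) hW' ha
      (fun y hy => h₁ y (hBU hy)) (fun y hy => h₂ y (hBU hy)) hcase hpos
    have hne : fderiv ℝ W x (EuclideanSpace.single 0 1) ≠ 0 ∨ fderiv ℝ W x (EuclideanSpace.single 1 1) ≠ 0 := by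
      by_contra hcon
      push Not at hcon
      have h0 := h₁ x hx
      rw [hcon.1, hcon.2] at h0
      linarith
    exact ⟨ball x δ, isOpen_ball, ⟨x, mem_ball_self hδ⟩, hδB.trans hBU, Or.inr ⟨hne, hpar⟩⟩

end Lines

end Literature.Analysis.Calculus.PlaneIsoparametric

end
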